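import Mathlib

/-!
# P7Dim8PackingExample — the finite combinatorics of P7-Dim8PackingCheck Example 3.5 (reducible ≠ packable)

Kernel-checked bookkeeping (README §2 / R-5: finite algebra decided by `decide`, never the discharge of a Hodge-theoretic
step) for the abstract CM configuration of block sizes `(6,1,1)` of proofs/P7-Dim8PackingCheck.md §3, Example 3.5:

* `T = ℤ/6 × ℤ/2` acting regularly on the 12 points of the sixfold block (point `(m, e)` encoded as `m + 6 e`, `m < 6`,
  `e < 2`), through `ℤ/2` on the two points `12, 13` of the curve `E` and `14, 15` of the curve `E'`; `ι = (0, 1)`,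
  `H = ℤ/6 × 0`; the `k`-Weil 8-set `x = {0,…,5} ⊔ {12} ⊔ {14}` (the `s`-fibres);
* the type `Φ` with `Φ ∩ x_S = {0, 1}` (so `a = (2, 1, 1)`), `Φ_E = {12}`, `Φ_{E'} = {14}`, and the contrast type `Φ'`
  with `Φ' ∩ x_S = {0, 2}`;
* `balanced Φ Δ` = `|Δ|` even and `|tΔ ∩ Φ| = |Δ|/2` for every `t ∈ T` (Definition 1.1 of P5-LowDimCensus).

Certified: (1) both types are primitive (the inflation `F_σ = {t : tσ ∈ Φ}`, `σ = 0`, has trivial right-stabiliser);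
(2) `x` is balanced for both; (3) for `Φ`, `x = Δ₁ ⊔ Δ₂` with `Δ₁ = {0,2,4,12}`, `Δ₂ = {1,3,5,14}` both balanced — `x` is
NOT primitive — and neither piece contains a balanced 2-subset (both are exceptional), the stabiliser of `Δ₁` in `T` is
`{(0,0),(2,0),(4,0)}` (orbit size `12/3 = 4`), neither piece is a union of whole `k`-fibres; (4) for `Φ'`, `x` has NO
balanced decomposition at all (every proper non-empty subset of `x` fails balancedness): `x` is primitive.
The meaning of these numbers (Thm C's cup-product reading, the (6,1)-row classes, the packing obstruction) is the text.
-/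

namespace HodgeRepro0.P7Dim8PackingExample

/-- the group `T = ℤ/6 × ℤ/2` (additive, abelian). -/
abbrev T := Fin 6 × Fin 2

/-- the 12 elements of `T`, as a list. -/
def elems : List T := (List.finRange 6).flatMap fun m => (List.finRange 2).map fun e => (m, e)

/-- the 16 points: `m + 6 e` (`m < 6`, `e < 2`) for the sixfold block, `12 + e` for `E`, `14 + e` for `E'`. -/
abbrev P := Fin 16

/-- the action of `t = (a, b) ∈ T` on a point: translation on the sixfold block, the sign `b` on the curve pairs. -/
def act (t : T) (p : P) : P :=
  if h : p.val < 12 then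
    ⟨((p.val % 6 + t.1.val) % 6) + 6 * ((p.val / 6 + t.2.val) % 2), by omega⟩
  else if p.val < 14 then ⟨12 + ((p.val - 12 + t.2.val) % 2), by omega⟩
  else ⟨14 + ((p.val - 14 + t.2.val) % 2), by omega⟩

/-- the type `Φ` of Example 3.5: `Φ ∩ x_S = {0, 1}`, `Φ ∩ ιx_S = ι{2,3,4,5} = {8,9,10,11}`, `Φ_E = {12}`, `Φ_{E'} = {14}`. -/
def Phi (p : P) : Bool := p.val ∈ [0, 1, 8, 9, 10, 11, 12, 14]

/-- the contrast type `Φ'`: `Φ' ∩ x_S = {0, 2}`, `Φ' ∩ ιx_S = ι{1,3,4,5} = {7,9,10,11}`, the curves as for `Φ`. -/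
def Phi' (p : P) : Bool := p.val ∈ [0, 2, 7, 9, 10, 11, 12, 14]

/-- `Δ` is balanced for the type `F`: even size and `|tΔ ∩ F| = |Δ|/2` for every `t ∈ T`. -/
def balanced (F : P → Bool) (Δ : List P) : Bool :=
  Δ.length % 2 = 0 && elems.all fun t => (Δ.filter fun p => F (act t p)).length * 2 = Δ.length

/-- the `k`-Weil 8-set: the `s`-fibres `{0,…,5}`, `{12}`, `{14}`. -/
def x : List P := [0, 1, 2, 3, 4, 5, 12, 14]
/-- the first piece of the decomposition of Example 3.5. -/
def Δ₁ : List P := [0, 2, 4, 12]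
/-- the second piece (the complement of `Δ₁` in `x`). -/
def Δ₂ : List P := [1, 3, 5, 14]

/-- `Φ` and `Φ'` are types: exactly one point of every `ι`-pair (`ι = (0,1)`) lies in them. -/
theorem types : (List.finRange 16).all (fun p => Phi p != Phi (act (0, 1) p)) = true ∧
    (List.finRange 16).all (fun p => Phi' p != Phi' (act (0, 1) p)) = true := by decide

/-- the a-vector of `x` for `Φ` is `(2, 1, 1)`, for `Φ'` also `(2, 1, 1)`. -/
theorem avector :
    ((x.take 6).filter Phi).length = 2 ∧ Phi 12 = true ∧ Phi 14 = true ∧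
    ((x.take 6).filter Phi').length = 2 ∧ Phi' 12 = true ∧ Phi' 14 = true := by decide

/-- the inflation `F_σ = {t : t·0 ∈ Φ}` of the sixfold's type through `σ = 0` has trivial right-stabiliser
(`T` abelian: `F_σ g = F_σ ⟺ ∀ t, [t ∈ F_σ] = [t + g ∈ F_σ]`): `Φ_S` is primitive — and likewise `Φ'_S`. -/
theorem primitive_types :
    elems.all (fun g => (elems.all fun t => Phi (act t 0) == Phi (act (t + g) 0)) → g == (0, 0)) = true ∧
    elems.all (fun g => (elems.all fun t => Phi' (act t 0) == Phi' (act (t + g) 0)) → g == (0, 0)) = true := by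
  decide

/-- `x` is balanced for both types (`a`-sum `4`). -/
theorem x_balanced : balanced Phi x = true ∧ balanced Phi' x = true := by decide

/-- for `Φ`, `x = Δ₁ ⊔ Δ₂` with both pieces balanced: `x` is NOT primitive. -/
theorem decomposition : balanced Phi Δ₁ = true ∧ balanced Phi Δ₂ = true ∧
    (Δ₁ ++ Δ₂).length = x.length ∧ x.all (fun p => p ∈ Δ₁ ++ Δ₂) = true ∧
    Δ₁.all (fun p => p ∉ Δ₂) = true := by decide

/-- neither piece contains a balanced 2-subset: both are exceptional balanced 4-sets. -/
theorem pieces_exceptional :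
    (Δ₁.flatMap fun p => Δ₁.map fun q => (p, q)).all
      (fun pq => pq.1 == pq.2 || !balanced Phi [pq.1, pq.2]) = true ∧
    (Δ₂.flatMap fun p => Δ₂.map fun q => (p, q)).all
      (fun pq => pq.1 == pq.2 || !balanced Phi [pq.1, pq.2]) = true := by decide

/-- the stabiliser of `Δ₁` in `T` (`act t` is a bijection, so `tΔ₁ ⊆ Δ₁ ⟺ tΔ₁ = Δ₁`) is `{(0,0),(2,0),(4,0)}`:
orbit size `12/3 = 4`, i.e. `[K_O : ℚ] = 4` (biquadratic: `T/⟨(2,0)⟩ ≅ ℤ/2 × ℤ/2`); the same for `Δ₂`. -/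
theorem stabiliser :
    elems.filter (fun t => Δ₁.all fun p => act t p ∈ Δ₁) = [(0, 0), (2, 0), (4, 0)] ∧
    elems.filter (fun t => Δ₂.all fun p => act t p ∈ Δ₂) = [(0, 0), (2, 0), (4, 0)] := by decide

/-- neither piece is a union of whole `k`-fibres: each meets the sixfold's fibre `{0,…,5}` in exactly 3 points. -/
theorem not_fibre_union : (Δ₁.filter fun p => p.val < 6).length = 3 ∧
    (Δ₂.filter fun p => p.val < 6).length = 3 := by decide

/-- the subset of `x` selected by the bits of `m = 16 a + b < 256` (`a`, `b < 16`). -/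
def sub (a b : Fin 16) : List P :=
  (List.finRange 8).filterMap fun i => if (16 * a.val + b.val) / 2 ^ i.val % 2 = 1 then x[i.val]? else none

/-- `m = 16 a + b` is a proper non-empty subset mask (neither `0` nor `255`). -/
def proper (a b : Fin 16) : Bool := !(a.val == 0 && b.val == 0) && !(a.val == 15 && b.val == 15)

/-- for the contrast type `Φ'`, NO proper non-empty subset of `x` is balanced: `x` is primitive
(every decomposition `x = Δ₁ ⊔ Δ₂` into balanced parts would make `Δ₁` such a subset). -/
theorem x_primitive_Phi' :
    (List.finRange 16).all (fun a => (List.finRange 16).all fun b =>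
      !proper a b || !balanced Phi' (sub a b)) = true := by
  decide

/-- for `Φ`, the balanced proper non-empty subsets of `x` are exactly four — `Δ₁`, `Δ₂` and `{0,2,4,14}`, `{1,3,5,12}`
(the two decompositions of the deposited script): their count is `4`. -/
theorem count_balanced_subsets_Phi :
    ((List.finRange 16).map fun a =>
      ((List.finRange 16).filter fun b => proper a b && balanced Phi (sub a b)).length).sum = 4 := by
  decide

end HodgeRepro0.P7Dim8PackingExample
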